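import Mathlib

/-!
# Stub `stub_actZero` for line `Sketch` of crux `FixedPointFreeTargets`
(stmt-MatrixMultiplication-15042)

The pinned Pauli "sandwich" action `act` of `E = ((Z/p)^k × (Z/p)^k)^3` on tensors
`V = (I × I) → (I × I) → (I × I) → ℂ` (`I = Fin k → ZMod p`) is built from the Weyl–Heisenberg
matrices `P x z` (entry `exp(2πi⟨z,v⟩/p)` at `(v + x, v)`).  This file proves the unit law of the
action: at `g = 0` all six matrices are `P 0 0 = 1`, so the triple sum defining `act 0 x a b c`
collapses to `x a b c`.
-/

set_option linter.dupNamespace false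

noncomputable section

namespace Summit.MatrixMultiplication.MatrixMultiplication.Theorems.PauliTautologicalTarget

open scoped BigOperators ComplexConjugate

/-- A product of two Kronecker deltas on the components of a pair is the Kronecker delta of the
pair. -/
private theorem ite_fst_mul_ite_snd {α β : Type*} [DecidableEq α] [DecidableEq β]
    (u v : α × β) :
    ((if u.1 = v.1 then (1 : ℂ) else 0) * if u.2 = v.2 then (1 : ℂ) else 0) =
      if u = v then 1 else 0 := by
  rcases u with ⟨u₁, u₂⟩
  rcases v with ⟨v₁, v₂⟩
  simp only [Prod.mk.injEq]
  by_cases h₁ : u₁ = v₁ <;> by_cases h₂ : u₂ = v₂ <;> simp [h₁, h₂]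

section Pinned

variable {p k : ℕ}
  {P : (Fin k → ZMod p) → (Fin k → ZMod p) → Matrix (Fin k → ZMod p) (Fin k → ZMod p) ℂ}
  {act : ((Fin k → ZMod p) × (Fin k → ZMod p)) × ((Fin k → ZMod p) × (Fin k → ZMod p)) ×
      ((Fin k → ZMod p) × (Fin k → ZMod p)) →
    (((Fin k → ZMod p) × (Fin k → ZMod p)) → ((Fin k → ZMod p) × (Fin k → ZMod p)) →
      ((Fin k → ZMod p) × (Fin k → ZMod p)) → ℂ) →
    (((Fin k → ZMod p) × (Fin k → ZMod p)) → ((Fin k → ZMod p) × (Fin k → ZMod p)) →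
      ((Fin k → ZMod p) × (Fin k → ZMod p)) → ℂ)}

/-- The pinned sandwich action at `g = 0` is the identity (`P_(0,0) = 1`). -/
theorem stub_actZero [Fact p.Prime]
    (hP : ∀ x z u v, P x z u v = if u = v + x then
      Complex.exp (2 * Real.pi * Complex.I * ((∑ i, z i * v i).val : ℂ) / (p : ℂ)) else 0)
    (hact : ∀ g x a b c, act g x a b c = ∑ a', ∑ b', ∑ c',
      (starRingEnd ℂ (P g.1.1 g.1.2 a.1 a'.1) * P g.2.2.1 g.2.2.2 a.2 a'.2) *
      (P g.1.1 g.1.2 b.1 b'.1 * starRingEnd ℂ (P g.2.1.1 g.2.1.2 b.2 b'.2)) *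
      (P g.2.1.1 g.2.1.2 c.1 c'.1 * starRingEnd ℂ (P g.2.2.1 g.2.2.2 c.2 c'.2)) * x a' b' c')
    (x : ((Fin k → ZMod p) × (Fin k → ZMod p)) → ((Fin k → ZMod p) × (Fin k → ZMod p)) →
      ((Fin k → ZMod p) × (Fin k → ZMod p)) → ℂ) :
    act 0 x = x := by
  -- entries of `P 0 0`: the identity matrix
  have hP0 : ∀ u v : Fin k → ZMod p, P 0 0 u v = if u = v then 1 else 0 := by
    intro u v
    rw [hP]
    simp only [add_zero, Pi.zero_apply, zero_mul, Finset.sum_const_zero, ZMod.val_zero,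
      Nat.cast_zero, mul_zero, zero_div, Complex.exp_zero]
  funext a b c
  rw [hact]
  simp only [Prod.fst_zero, Prod.snd_zero, hP0, MonoidWithZeroHom.map_ite_one_zero]
  simp only [ite_fst_mul_ite_snd]
  simp only [ite_mul, one_mul, zero_mul, Finset.sum_ite_irrel, Finset.sum_const_zero,
    Finset.sum_ite_eq, Finset.mem_univ, if_true]

end Pinned

end Summit.MatrixMultiplication.MatrixMultiplication.Theorems.PauliTautologicalTarget

end
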